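import Mathlib
import HarnessLib
import Summits.Ventures.LatticeQCDFlow.Scaling.TiltedProtocolMoments

/-!
# WorkExponentialMomentsAnyGrid — the work-MGF envelope of `Scaling/WorkExponentialMoments` along
# an ARBITRARY monotone grid with steps `0 ≤ δ_k ≤ δ̄` (e.g. the registry's `protocol.schedule =
# power`): `log E_F[e^{−t(W−ΔF)}] ≤ (½[t(t−1)]₊ + |t(t−1)|·θ/(1−θ))·σ̄²·δ̄·(c_n − c_0)`,
# `θ = ρ·e^{(5|t|+2|t−1|)δ̄ΔD/4}` — the uniform grid (`δ̄ = 1/n`, `c_n − c_0 = 1`) is the special case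

HONEST FRAMING: exact (Metropolis-corrected) sampling algorithms for lattice gauge theory;
figures of merit are autocorrelation/cost numbers at stated couplings and volumes; no
continuum-physics claim.

Venture `LatticeQCDFlow` (cell pub-lqcd), topic `Scaling`; FANOUT row 19 (`su2-snf`, GEN-6).
OUR WORK (elementary finite sums), nothing cited as a fact.  The per-step inequalities of
`Scaling/TiltedProtocolMoments` hold on any grid `c : ℕ → ℝ`; only the closed form of
`Scaling/WorkExponentialMoments` used `δ_k = 1/n`.  Here the steps are only assumed non-negative and
bounded, `0 ≤ c_{k+1} − c_k ≤ δ̄`; the 2×2 majorant system then has step-proportional coefficients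
(`s_k = S·δ_k`, `a_k = A·δ_k`, `θ_k ≤ θ`) and is solved by `coupled_majorant_bound_weighted`
(`u_n ≤ Π_k(1 + κδ_k) ≤ exp(κ·Σ_kδ_k) = exp(κ(c_n − c_0))`, `κ = S·A·δ̄/(1−θ)`); the perfect part is
`Σ_k Λ_k(t) ≤ ½[t(t−1)]₊·σ̄²·Σ_kδ_k² ≤ ½[t(t−1)]₊·σ̄²·δ̄·(c_n − c_0)`.

* `coupled_majorant_bound_weighted`, `prod_one_add_le_exp_sum` — the weighted majorant lemma;
* `tTiltMass_le_of_steps` — `|ν_n^{(t)}| ≤ p_n^{(t)}·exp(|t(t−1)|·θ/(1−θ)·σ̄²·δ̄·(c_n − c_0))`;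
* the perfect part `Σ_{k<n} Λ_k(t) ≤ ½[t(t−1)]₊·σ̄²·δ̄·(c_n − c_0)` is
  `Scaling/LinearFamilyStepMGF.sum_stepLogMGF_le_of_steps`;
* **`expMoment_work_le_of_steps`** — the envelope above for `E_F[e^{−t(W − (F(c_n) − F(c_0)))}]`.

Reading (value-free): at equal total span and equal LARGEST step the certified envelope is the
same for every schedule; a non-uniform schedule (power law, geometric) is certified through its
largest step `δ̄` — the envelope cannot see gains from adapting the grid to `Var_c(D)` (those live in
the perfect part `Σ_kδ_k²Var_{c_k}`, kept here only through `σ̄²`).  NOT CLAIMED: optimal schedules;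
any value of `ρ`, `σ̄`, `ΔD` for a lattice kernel.
-/

namespace Summit.Ventures.LatticeQCDFlow.Scaling

open Finset
open Literature.Probability.MarkovChains (IsRowStochastic IsStationary stepLaw)
open Summit.Ventures.LatticeQCDFlow.Exactness
open Summit.Ventures.LatticeQCDFlow.Theory2

variable {X : Type*} [Fintype X] [Nonempty X]

/-! ## Variable-coefficient majorant system (any grid) -/

/-- **Coupled majorant system with step weights.**  If `u_0 ≤ 1`, `v_0 ≤ 0`,
`u_{k+1} ≤ u_k + S·w_k·v_k`, `v_{k+1} ≤ A·w_k·u_k + θ·v_k` with `S, A ≥ 0`, `0 ≤ w_k ≤ w̄`,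
`0 ≤ θ < 1`, then with `κ = S·A·w̄/(1−θ)`: `u_k ≤ Π_{i<k} (1 + κ·w_i)` and
`v_k ≤ (A·w̄/(1−θ))·Π_{i<k} (1 + κ·w_i)`. -/
theorem coupled_majorant_bound_weighted {u v w : ℕ → ℝ} {S A θ wbar : ℝ} (hS : 0 ≤ S) (hA : 0 ≤ A)
    (hθ0 : 0 ≤ θ) (hθ1 : θ < 1) (hw : ∀ k, 0 ≤ w k) (hwbar : ∀ k, w k ≤ wbar)
    (hu0 : u 0 ≤ 1) (hv0 : v 0 ≤ 0)
    (hu : ∀ k, u (k + 1) ≤ u k + S * w k * v k) (hv : ∀ k, v (k + 1) ≤ A * w k * u k + θ * v k) :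
    ∀ k, u k ≤ ∏ i ∈ Finset.range k, (1 + S * A * wbar / (1 - θ) * w i)
      ∧ v k ≤ A * wbar / (1 - θ) * ∏ i ∈ Finset.range k, (1 + S * A * wbar / (1 - θ) * w i)
  | 0 => by
    have hwbar0 : 0 ≤ wbar := (hw 0).trans (hwbar 0)
    refine ⟨by simpa using hu0, ?_⟩
    rw [Finset.prod_range_zero, mul_one]
    exact hv0.trans (div_nonneg (mul_nonneg hA hwbar0) (by linarith))
  | k + 1 => by
    obtain ⟨ihu, ihv⟩ := coupled_majorant_bound_weighted hS hA hθ0 hθ1 hw hwbar hu0 hv0 hu hv k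
    have h1θ : 0 < 1 - θ := by linarith
    have hwbar0 : 0 ≤ wbar := (hw 0).trans (hwbar 0)
    have hκ : 0 ≤ S * A * wbar / (1 - θ) := div_nonneg (by positivity) h1θ.le
    set B := ∏ i ∈ Finset.range k, (1 + S * A * wbar / (1 - θ) * w i) with hB
    have hB0 : 0 ≤ B := Finset.prod_nonneg fun i _ => by nlinarith [hw i, hκ]
    have hBsucc : ∏ i ∈ Finset.range (k + 1), (1 + S * A * wbar / (1 - θ) * w i)
        = B * (1 + S * A * wbar / (1 - θ) * w k) := Finset.prod_range_succ _ _
    have hfac : 1 ≤ 1 + S * A * wbar / (1 - θ) * w k := by nlinarith [hw k, hκ]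
    constructor
    · calc u (k + 1) ≤ u k + S * w k * v k := hu k
        _ ≤ B + S * w k * (A * wbar / (1 - θ) * B) :=
            add_le_add ihu (mul_le_mul_of_nonneg_left ihv (mul_nonneg hS (hw k)))
        _ = B * (1 + S * A * wbar / (1 - θ) * w k) := by ring
        _ = _ := hBsucc.symm
    · calc v (k + 1) ≤ A * w k * u k + θ * v k := hv k
        _ ≤ A * wbar * B + θ * (A * wbar / (1 - θ) * B) := by
            have h1 : A * w k * u k ≤ A * wbar * B := by
              calc A * w k * u k ≤ A * w k * B :=
                    mul_le_mul_of_nonneg_left ihu (mul_nonneg hA (hw k))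
                _ ≤ A * wbar * B := by
                    have := mul_le_mul_of_nonneg_left (hwbar k) hA
                    nlinarith [hB0, this]
            exact add_le_add h1 (mul_le_mul_of_nonneg_left ihv hθ0)
        _ = A * wbar / (1 - θ) * B := by field_simp; ring
        _ ≤ A * wbar / (1 - θ) * ∏ i ∈ Finset.range (k + 1), (1 + S * A * wbar / (1 - θ) * w i) := by
            rw [hBsucc]
            refine mul_le_mul_of_nonneg_left ?_ (div_nonneg (mul_nonneg hA hwbar0) h1θ.le)
            have : B * 1 ≤ B * (1 + S * A * wbar / (1 - θ) * w k) := mul_le_mul_of_nonneg_left hfac hB0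
            simpa using this

/-- `Π (1 + κ w_i) ≤ exp(κ Σ w_i)` for `κ, w_i ≥ 0`. -/
theorem prod_one_add_le_exp_sum {w : ℕ → ℝ} {κ : ℝ} (hκ : 0 ≤ κ) (hw : ∀ k, 0 ≤ w k) (n : ℕ) :
    ∏ i ∈ Finset.range n, (1 + κ * w i) ≤ Real.exp (κ * ∑ i ∈ Finset.range n, w i) := by
  rw [Finset.mul_sum, Real.exp_sum]
  exact Finset.prod_le_prod (fun i _ => by nlinarith [hw i]) fun i _ => by
    have := Real.add_one_le_exp (κ * w i); linarith

/-! ## The tilted mass along a grid with bounded steps -/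

/-- **`t`-TILTED MASS ALONG A MONOTONE GRID WITH STEPS `≤ δ̄`.**  With
`θ = ρ·e^{(5|t|+2|t−1|)δ̄ΔD/4} < 1`:
`|ν_n^{(t)}| ≤ p_n^{(t)} · exp(|t(t−1)|·θ/(1−θ)·σ̄²·δ̄·(c_n − c_0))`. -/
theorem tTiltMass_le_of_steps (t : ℝ) (S₀ D : X → ℝ) (c : ℕ → ℝ) (P : ℕ → X → X → ℝ) (n : ℕ)
    {ΔD ρ σbar δbar : ℝ} (hD : ∀ x y, |D x - D y| ≤ ΔD) (hPpos : ∀ k x y, 0 < P k x y)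
    (hProw : ∀ k x, ∑ y, P k x y = 1)
    (hK : ∀ k, ChiSqContracts (P k) (gibbsLaw (linAction S₀ D (c (k + 1)))) ρ)
    (hρ : 0 ≤ ρ) (hσ0 : 0 ≤ σbar) (hσ : ∀ c', varD S₀ D c' ≤ σbar ^ 2)
    (hmono : ∀ k, 0 ≤ c (k + 1) - c k) (hstep : ∀ k, c (k + 1) - c k ≤ δbar)
    (hθ1 : ρ * Real.exp ((5 * |t| + 2 * |t - 1|) * δbar * ΔD / 4) < 1) :
    ∑ x, tTiltLaw t S₀ D c P n x
      ≤ tPerfMass t S₀ D c n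
          * Real.exp (|t * (t - 1)| * ((ρ * Real.exp ((5 * |t| + 2 * |t - 1|) * δbar * ΔD / 4))
              / (1 - ρ * Real.exp ((5 * |t| + 2 * |t - 1|) * δbar * ΔD / 4)))
              * σbar ^ 2 * δbar * (c n - c 0)) := by
  have hΔ : 0 ≤ ΔD := (abs_nonneg _).trans (hD (Classical.arbitrary X) (Classical.arbitrary X))
  have hδbar0 : 0 ≤ δbar := (hmono 0).trans (hstep 0)
  -- sequences and constants
  set m : ℕ → ℝ := fun k => ∑ x, tTiltLaw t S₀ D c P k x with hm
  set E : ℕ → ℝ := fun k => massDev (gibbsLaw (linAction S₀ D (c k))) (tTiltLaw t S₀ D c P k) with hE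
  set p : ℕ → ℝ := fun k => tPerfMass t S₀ D c k with hp
  set gb : ℕ → ℝ := fun k => ∑ x, gibbsLaw (linAction S₀ D (c k)) x * tWeight t D c k x with hgb
  set w : ℕ → ℝ := fun k => c (k + 1) - c k with hw
  have hp0 : ∀ k, 0 < p k := fun k => tPerfMass_pos t S₀ D c k
  have hgb0 : ∀ k, 0 < gb k := fun k => tEqFactor_pos t S₀ D c k
  have hpsucc : ∀ k, p (k + 1) = p k * gb k := fun k => tPerfMass_succ t S₀ D c k
  set S : ℝ := |t| * Real.exp (|t| * δbar * ΔD / 2) * σbar with hS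
  set A : ℝ := ρ * (|t - 1| * Real.exp (|t - 1| * δbar * ΔD / 2) * σbar) with hA
  set θ : ℝ := ρ * Real.exp ((5 * |t| + 2 * |t - 1|) * δbar * ΔD / 4) with hθ
  have hS0 : 0 ≤ S := by positivity
  have hA0 : 0 ≤ A := by positivity
  have hθ0 : 0 ≤ θ := by positivity
  have habs1 : ∀ k, |t * w k| = |t| * w k := fun k => by rw [abs_mul, abs_of_nonneg (hmono k)]
  have habs2 : ∀ k, |t * w k - w k| = |t - 1| * w k := fun k => by
    rw [show t * w k - w k = (t - 1) * w k by ring, abs_mul, abs_of_nonneg (hmono k)]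
  -- monotonicity helpers in the step
  have hexp_le : ∀ (a : ℝ) (k : ℕ), 0 ≤ a → Real.exp (a * w k * ΔD / 2) ≤ Real.exp (a * δbar * ΔD / 2) := by
    intro a k ha
    refine Real.exp_le_exp.mpr ?_
    have := mul_le_mul_of_nonneg_left (hstep k) ha
    nlinarith [hΔ]
  -- per-step inequalities in weighted form
  have hu : ∀ k, m (k + 1) / p (k + 1) ≤ m k / p k + S * w k * (E k / p k) := by
    intro k
    have step := sum_tTiltLaw_succ_le t S₀ D c P hD hProw hσ0 hσ k
    rw [habs1 k] at step
    rw [hpsucc, div_le_iff₀ (mul_pos (hp0 k) (hgb0 k))]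
    have hpk := (hp0 k).ne'
    -- weaken the step constant: e^{|t| w_k ΔD/2} ≤ e^{|t| δ̄ ΔD/2}
    have hE0 : 0 ≤ E k := massDev_nonneg _ _
    have hle : gb k * (m k + |t| * w k * Real.exp (|t| * w k * ΔD / 2) * σbar * E k)
        ≤ gb k * (m k + S * w k * E k) := by
      refine mul_le_mul_of_nonneg_left (add_le_add le_rfl ?_) (hgb0 k).le
      rw [hS]
      have h1 := hexp_le |t| k (abs_nonneg t)
      have : |t| * w k * Real.exp (|t| * w k * ΔD / 2) ≤ |t| * w k * Real.exp (|t| * δbar * ΔD / 2) :=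
        mul_le_mul_of_nonneg_left h1 (mul_nonneg (abs_nonneg t) (hmono k))
      have := mul_le_mul_of_nonneg_right (mul_le_mul_of_nonneg_right this hσ0) hE0
      nlinarith [this]
    have e : (m k / p k + S * w k * (E k / p k)) * (p k * gb k) = gb k * (m k + S * w k * E k) := by
      field_simp
    rw [e]
    exact step.trans hle
  have hv : ∀ k, E (k + 1) / p (k + 1) ≤ A * w k * (m k / p k) + θ * (E k / p k) := by
    intro k
    have step := massDev_tTiltLaw_succ_le t S₀ D c P hD hPpos hProw (fun k => hK k) hρ hσ0 hσ k
    rw [habs1 k, habs2 k] at step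
    rw [hpsucc, div_le_iff₀ (mul_pos (hp0 k) (hgb0 k))]
    have hpk := (hp0 k).ne'
    have hE0 : 0 ≤ E k := massDev_nonneg _ _
    have hm0 : 0 ≤ m k := sum_nonneg fun x _ => (tTiltLaw_pos hPpos k x).le
    -- weaken: θ_k ≤ θ and e^{|t-1| w_k ΔD/2} ≤ e^{|t-1| δ̄ ΔD/2}
    have hθk : ρ * Real.exp ((5 * (|t| * w k * ΔD) + 2 * (|t - 1| * w k * ΔD)) / 4) ≤ θ := by
      rw [hθ]
      refine mul_le_mul_of_nonneg_left (Real.exp_le_exp.mpr ?_) hρ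
      have h5 : 0 ≤ 5 * |t| + 2 * |t - 1| := by positivity
      have := mul_le_mul_of_nonneg_left (hstep k) h5
      nlinarith [hΔ]
    have hle : ρ * gb k * (Real.exp ((5 * (|t| * w k * ΔD) + 2 * (|t - 1| * w k * ΔD)) / 4) * E k
          + |t - 1| * w k * Real.exp (|t - 1| * w k * ΔD / 2) * σbar * m k)
        ≤ gb k * (θ * E k + A * w k * m k) := by
      have h1 : ρ * Real.exp ((5 * (|t| * w k * ΔD) + 2 * (|t - 1| * w k * ΔD)) / 4) * E k ≤ θ * E k :=
        mul_le_mul_of_nonneg_right hθk hE0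
      have h2e := hexp_le |t - 1| k (abs_nonneg _)
      have h2 : ρ * (|t - 1| * w k * Real.exp (|t - 1| * w k * ΔD / 2) * σbar) * m k ≤ A * w k * m k := by
        rw [hA]
        have : |t - 1| * w k * Real.exp (|t - 1| * w k * ΔD / 2) ≤ |t - 1| * w k * Real.exp (|t - 1| * δbar * ΔD / 2) :=
          mul_le_mul_of_nonneg_left h2e (mul_nonneg (abs_nonneg _) (hmono k))
        have := mul_le_mul_of_nonneg_right (mul_le_mul_of_nonneg_left
          (mul_le_mul_of_nonneg_right this hσ0) hρ) hm0
        nlinarith [this]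
      nlinarith [h1, h2, (hgb0 k).le, mul_le_mul_of_nonneg_left (add_le_add h1 h2) (hgb0 k).le]
    have e : (A * w k * (m k / p k) + θ * (E k / p k)) * (p k * gb k) = gb k * (θ * E k + A * w k * m k) := by
      field_simp; ring
    rw [e]
    refine le_trans ?_ hle
    have : ρ * gb k * (Real.exp ((5 * (|t| * w k * ΔD) + 2 * (|t - 1| * w k * ΔD)) / 4) * E k
        + |t - 1| * w k * Real.exp (|t - 1| * w k * ΔD / 2) * σbar * m k)
        = ρ * (∑ x, gibbsLaw (linAction S₀ D (c k)) x * tWeight t D c k x)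
          * (Real.exp ((5 * (|t| * (c (k + 1) - c k) * ΔD) + 2 * (|t - 1| * (c (k + 1) - c k) * ΔD)) / 4)
              * massDev (gibbsLaw (linAction S₀ D (c k))) (tTiltLaw t S₀ D c P k)
            + |t - 1| * (c (k + 1) - c k) * Real.exp (|t - 1| * (c (k + 1) - c k) * ΔD / 2) * σbar
              * ∑ x, tTiltLaw t S₀ D c P k x) := by rfl
    rw [this]
    exact step
  -- initial values
  have hu0 : m 0 / p 0 ≤ 1 := by
    rw [hm, hp]; simp only
    rw [tTiltLaw_zero, sum_gibbsLaw, tPerfMass, Finset.prod_range_zero, div_one]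
  have hv0 : E 0 / p 0 ≤ 0 := by
    rw [hE, hp]; simp only
    rw [tTiltLaw_zero, massDev_of_sum_eq_one _ (sum_gibbsLaw _), chiSqDiv_self_eq_zero,
      Real.sqrt_zero, zero_div]
  have hθ1' : θ < 1 := hθ1
  have hbound := (coupled_majorant_bound_weighted (u := fun k => m k / p k) (v := fun k => E k / p k)
    (w := w) hS0 hA0 hθ0 hθ1' hmono hstep hu0 hv0 hu hv n).1
  have hκ : 0 ≤ S * A * δbar / (1 - θ) := div_nonneg (by positivity) (by linarith)
  have hprod := prod_one_add_le_exp_sum hκ hmono n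
  -- Σ w = c n − c 0
  have hsumw : ∑ i ∈ Finset.range n, w i = c n - c 0 := by
    rw [hw]; simp only
    exact Finset.sum_range_sub c n
  have hfin : m n / p n ≤ Real.exp (S * A * δbar / (1 - θ) * (c n - c 0)) := by
    rw [← hsumw]; exact hbound.trans hprod
  -- compare the rate with the lag budget
  have hrate : S * A * δbar / (1 - θ) * (c n - c 0)
      ≤ |t * (t - 1)| * (θ / (1 - θ)) * σbar ^ 2 * δbar * (c n - c 0) := by
    have h1θ : 0 < 1 - θ := by linarith
    have hspan : 0 ≤ c n - c 0 := by rw [← hsumw]; exact sum_nonneg fun i _ => hmono i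
    have hexp : Real.exp (|t| * δbar * ΔD / 2) * Real.exp (|t - 1| * δbar * ΔD / 2)
        ≤ Real.exp ((5 * |t| + 2 * |t - 1|) * δbar * ΔD / 4) := by
      rw [← Real.exp_add]
      refine Real.exp_le_exp.mpr ?_
      nlinarith [abs_nonneg t, abs_nonneg (t - 1), mul_nonneg hδbar0 hΔ]
    have hSA : S * A ≤ |t * (t - 1)| * θ * σbar ^ 2 := by
      rw [hS, hA, hθ, abs_mul]
      have e1 : |t| * Real.exp (|t| * δbar * ΔD / 2) * σbar
            * (ρ * (|t - 1| * Real.exp (|t - 1| * δbar * ΔD / 2) * σbar))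
          = |t| * |t - 1| * (ρ * (Real.exp (|t| * δbar * ΔD / 2) * Real.exp (|t - 1| * δbar * ΔD / 2)))
              * σbar ^ 2 := by ring
      rw [e1]
      have := mul_le_mul_of_nonneg_left hexp hρ
      have htt : 0 ≤ |t| * |t - 1| := by positivity
      have := mul_le_mul_of_nonneg_left (mul_le_mul_of_nonneg_right this (sq_nonneg σbar)) htt
      nlinarith [this]
    rw [show S * A * δbar / (1 - θ) * (c n - c 0) = S * A * (δbar * (c n - c 0)) / (1 - θ) by ring,
      show |t * (t - 1)| * (θ / (1 - θ)) * σbar ^ 2 * δbar * (c n - c 0)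
        = |t * (t - 1)| * θ * σbar ^ 2 * (δbar * (c n - c 0)) / (1 - θ) by ring]
    exact div_le_div_of_nonneg_right (mul_le_mul_of_nonneg_right hSA (mul_nonneg hδbar0 hspan)) h1θ.le
  have hfin' := hfin.trans (Real.exp_le_exp.mpr hrate)
  calc m n ≤ Real.exp (|t * (t - 1)| * (θ / (1 - θ)) * σbar ^ 2 * δbar * (c n - c 0)) * p n :=
        (div_le_iff₀ (hp0 n)).mp hfin'
    _ = p n * Real.exp (|t * (t - 1)| * (θ / (1 - θ)) * σbar ^ 2 * δbar * (c n - c 0)) := mul_comm _ _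

/-- **THE MGF ENVELOPE ALONG A MONOTONE GRID WITH STEPS `≤ δ̄` (arbitrary layers).**
`E_F[e^{−t(W − (F(c_n) − F(c_0)))}] ≤ exp((½[t(t−1)]₊ + |t(t−1)|·θ/(1−θ))·σ̄²·δ̄·(c_n − c_0))`,
`θ = ρ·e^{(5|t|+2|t−1|)δ̄ΔD/4} < 1`. -/
theorem expMoment_work_le_of_steps (t : ℝ) (S₀ D : X → ℝ) (c : ℕ → ℝ) (P : ℕ → X → X → ℝ)
    (n : ℕ) {ΔD ρ σbar δbar : ℝ} (hD : ∀ x y, |D x - D y| ≤ ΔD) (hPpos : ∀ k x y, 0 < P k x y)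
    (hProw : ∀ k x, ∑ y, P k x y = 1)
    (hK : ∀ k, ChiSqContracts (P k) (gibbsLaw (linAction S₀ D (c (k + 1)))) ρ)
    (hρ : 0 ≤ ρ) (hσ0 : 0 ≤ σbar) (hσ : ∀ c', varD S₀ D c' ≤ σbar ^ 2)
    (hmono : ∀ k, 0 ≤ c (k + 1) - c k) (hstep : ∀ k, c (k + 1) - c k ≤ δbar)
    (hθ1 : ρ * Real.exp ((5 * |t| + 2 * |t - 1|) * δbar * ΔD / 4) < 1) :
    ∑ ω : Fin (n + 1) → X,
        pathLaw (gibbsLaw (linAction S₀ D (c 0))) (fun k : Fin n => P k) ω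
          * Real.exp (-(t * (work (fun k : Fin (n + 1) => linAction S₀ D (c k)) ω
              - (linFreeEnergy S₀ D (c n) - linFreeEnergy S₀ D (c 0)))))
      ≤ Real.exp ((max (t * (t - 1)) 0 / 2
          + |t * (t - 1)| * ((ρ * Real.exp ((5 * |t| + 2 * |t - 1|) * δbar * ΔD / 4))
              / (1 - ρ * Real.exp ((5 * |t| + 2 * |t - 1|) * δbar * ΔD / 4))))
          * σbar ^ 2 * δbar * (c n - c 0)) := by
  set θ : ℝ := ρ * Real.exp ((5 * |t| + 2 * |t - 1|) * δbar * ΔD / 4) with hθ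
  set ΔF := linFreeEnergy S₀ D (c n) - linFreeEnergy S₀ D (c 0) with hΔF
  have hsplit : ∀ ω : Fin (n + 1) → X,
      pathLaw (gibbsLaw (linAction S₀ D (c 0))) (fun k : Fin n => P k) ω
          * Real.exp (-(t * (work (fun k : Fin (n + 1) => linAction S₀ D (c k)) ω - ΔF)))
        = Real.exp (t * ΔF)
          * (pathLaw (gibbsLaw (linAction S₀ D (c 0))) (fun k : Fin n => P k) ω
            * Real.exp (-(t * work (fun k : Fin (n + 1) => linAction S₀ D (c k)) ω))) := by
    intro ω
    rw [show -(t * (work (fun k : Fin (n + 1) => linAction S₀ D (c k)) ω - ΔF))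
        = t * ΔF + -(t * work (fun k : Fin (n + 1) => linAction S₀ D (c k)) ω) by ring, Real.exp_add]
    ring
  simp_rw [hsplit]
  rw [← mul_sum, sum_pathLaw_exp_neg_mul_work_eq t S₀ D c P n]
  have hmass := tTiltMass_le_of_steps t S₀ D c P n hD hPpos hProw hK hρ hσ0 hσ hmono hstep hθ1
  have hperf := log_tPerfMass_add_eq_sum_stepLogMGF t S₀ D c n
  have hsum := sum_stepLogMGF_le_of_steps t S₀ D c n (σbar := σbar) hσ hmono hstep
  have hp0 := tPerfMass_pos t S₀ D c n
  have hpexp : tPerfMass t S₀ D c n * Real.exp (t * ΔF)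
      = Real.exp (∑ k ∈ Finset.range n, stepLogMGF S₀ D (c k) (c (k + 1) - c k) t) := by
    rw [← hperf, Real.exp_add, Real.exp_log hp0, hΔF]
  calc Real.exp (t * ΔF) * ∑ x, tTiltLaw t S₀ D c P n x
      ≤ Real.exp (t * ΔF) * (tPerfMass t S₀ D c n
          * Real.exp (|t * (t - 1)| * (θ / (1 - θ)) * σbar ^ 2 * δbar * (c n - c 0))) :=
        mul_le_mul_of_nonneg_left hmass (Real.exp_pos _).le
    _ = Real.exp (∑ k ∈ Finset.range n, stepLogMGF S₀ D (c k) (c (k + 1) - c k) t)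
          * Real.exp (|t * (t - 1)| * (θ / (1 - θ)) * σbar ^ 2 * δbar * (c n - c 0)) := by
        rw [← hpexp]; ring
    _ ≤ Real.exp (max (t * (t - 1)) 0 / 2 * σbar ^ 2 * δbar * (c n - c 0))
          * Real.exp (|t * (t - 1)| * (θ / (1 - θ)) * σbar ^ 2 * δbar * (c n - c 0)) :=
        mul_le_mul_of_nonneg_right (Real.exp_le_exp.mpr hsum) (Real.exp_pos _).le
    _ = _ := by rw [← Real.exp_add]; congr 1; ring

end Summit.Ventures.LatticeQCDFlow.Scaling
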